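import Summits.QuantumFields.YangMills.Theorems.FlatTubeReductionOffTubeSuppressionPrelim
import Summits.QuantumFields.YangMills.Theorems.LuscherReductionRunningReductionLatticeIMSDefect
import HarnessLib

/-!
# Variational Agmon relocalisation for the zero-flux transfer form — preliminaries: the deficit form, the orthogonal split against the
# ground state, and the localisation of the ground state itself (crux K1b `ValleyRelocalisation` of route `FlatTubeReduction`,
# item stmt-QuantumFields-25191; rung R2b1 = RECORD-label femto gap)

Seat `ym-line-ftr-p1` g2 (prover).  Hilbert-space lemmas for the companion file `FlatTubeReductionValleyRelocalisationAgmon.lean` (proof path (ii)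
«IMS cut + valley gain» of the valley relocalisation), typed for an arbitrary gauge- and twist-invariant, link-Lipschitz phase `Θ` (near piece
`cos Θ ·`, far piece `sin Θ ·`) and an arbitrary action tube `T = {S ≤ η}`:

* §1 `deficit_sq_le` — Cauchy–Schwarz for the DEFICIT form `ν⟨x,y⟩ − ⟨x,K_βy⟩` on physical functions `⊥ Ω`, given `⟨f,K_βf⟩ ≤ ν‖f‖²` there;
  `orth_split` — for an exact eigenfunction `K_βΩ = λ₀Ω`: `g = g_⊥ + aΩ`, `‖g‖² = ‖g_⊥‖² + a²‖Ω‖²`, `⟨g,Kg⟩ = ⟨g_⊥,Kg_⊥⟩ + a²λ₀‖Ω‖²`.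
* §2 ★ `ground_far_mass_le` — a GAIN `⟨f,K_βf⟩ ≤ (1−γ)λ₀‖f‖²` for physical `f` supported in `T ∩ {sin Θ ≠ 0}` localises the positive ground
  state: `‖Ω‖² ≤ ‖cos Θ·1_T·Ω‖² + ω‖Ω‖²`, `ω = κ_η/λ₀ + (2/(γλ₀))((1 + 2/γ)κ_η + ε)`, with `κ_η = e^{−βη}c_β^{|E|}` RED's large-field
  suppression off the tube (`tail_bound`, `sq_cross_le`) and `ε = ½|E|²Λ²(3/β)c_β^{|E|}` the lattice IMS defect (`qform_le_localized_cos_sin_lat`):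
  IMS on `Ω`, gain on the far tube piece, Cauchy–Schwarz for the far off-tube cross term — the exact-eigenfunction case of Agmon's estimate.

HONEST FRAMING: Hilbert-space bookkeeping over the tree's IMS / large-field lemmas; the gain is a HYPOTHESIS (RED's `ValleyGainAt` at the matching
scale in the application).  R2b1 is a RECORD rung: nothing here concerns infinite volume, the continuum, or the Clay Yang–Mills mass gap.
No definitions, no named facts, no `sorry`.
-/

set_option autoImplicit false

noncomputable section

open MeasureTheory Filter Topology Real
open Literature.MathematicalPhysics.QuantumFieldTheory
open Literature.MathematicalPhysics.QuantumLattice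

namespace Summit.QuantumFields.YangMills.Theorems.FemtoTransferGap

namespace ValleyReloc

open Summit.QuantumFields.YangMills.Theorems.FemtoTransferGap.OffTube

variable {L : ℕ} [NeZero L]

/-! ## §1 Two Hilbert-space lemmas -/

/-- ★ **Cauchy–Schwarz for the deficit form.**  If `⟨f, K_β f⟩ ≤ ν‖f‖²` for every physical `f ⊥ Ω`, then for physical `x, y ⊥ Ω`:
`(ν⟨x,y⟩ − ⟨x,K_βy⟩)² ≤ (ν‖x‖² − ⟨x,Kx⟩)(ν‖y‖² − ⟨y,Ky⟩)` (discriminant of `t ↦ ν‖x+ty‖² − ⟨x+ty, K(x+ty)⟩ ≥ 0`). [cite: ReedSimonIV1978, Thm. XIII.1] -/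
theorem deficit_sq_le (β ν : ℝ) {Ω : GaugeConfig 3 L SU2 → ℝ} (hΩ : IsPhys Ω)
    (hν : ∀ f : GaugeConfig 3 L SU2 → ℝ, IsPhys f → l2 f Ω = 0 → qform su2Rep β f f ≤ ν * l2 f f)
    {x y : GaugeConfig 3 L SU2 → ℝ} (hx : IsPhys x) (hy : IsPhys y) (hxΩ : l2 x Ω = 0) (hyΩ : l2 y Ω = 0) :
    (ν * l2 x y - qform su2Rep β x y) ^ 2 ≤ (ν * l2 x x - qform su2Rep β x x) * (ν * l2 y y - qform su2Rep β y y) := by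
  have hquad : ∀ t : ℝ, 0 ≤ (ν * l2 y y - qform su2Rep β y y) * (t * t) + 2 * (ν * l2 x y - qform su2Rep β x y) * t +
      (ν * l2 x x - qform su2Rep β x x) := by
    intro t
    have hxt : IsPhys (x + t • y) := hx.add (hy.smul t)
    have horth : l2 (x + t • y) Ω = 0 := by rw [l2_add_left hx (hy.smul t) hΩ, l2_smul_left, hxΩ, hyΩ]; ring
    have h0 : qform su2Rep β (x + t • y) (x + t • y) ≤ ν * l2 (x + t • y) (x + t • y) := hν _ hxt horth
    have hq : qform su2Rep β (x + t • y) (x + t • y) = qform su2Rep β x x + 2 * t * qform su2Rep β x y + t ^ 2 * qform su2Rep β y y := by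
      rw [qform_add_add β hx (hy.smul t), qform_smul_right β t hx hy, qform_smul_left, qform_smul_right β t hy hy]; ring
    have hl : l2 (x + t • y) (x + t • y) = l2 x x + 2 * t * l2 x y + t ^ 2 * l2 y y := by
      rw [l2_add_add hx (hy.smul t), l2_comm x (t • y), l2_smul_left, l2_comm y x, l2_smul_left, l2_comm y (t • y), l2_smul_left]; ring
    rw [hq, hl] at h0
    nlinarith [h0]
  have hd := discrim_le_zero hquad
  rw [discrim] at hd
  nlinarith [hd]

/-- ★ **Orthogonal split against an exact eigenfunction.**  `K_βΩ = λ₀Ω`, `‖Ω‖² > 0`, `g` physical, `a = ⟨g,Ω⟩/‖Ω‖²`, `g_⊥ = g − aΩ`: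
`g_⊥ ⊥ Ω`, `‖g‖² = ‖g_⊥‖² + a²‖Ω‖²`, `⟨g,K_βg⟩ = ⟨g_⊥,K_βg_⊥⟩ + a²λ₀‖Ω‖²`. [folklore] -/
theorem orth_split (β : ℝ) {Ω g : GaugeConfig 3 L SU2 → ℝ} (hΩ : IsPhys Ω) (hg : IsPhys g)
    (heig : transferApply β Ω = topValue su2Rep L β • Ω) (hN : 0 < l2 Ω Ω) :
    l2 (g + (-(l2 g Ω / l2 Ω Ω)) • Ω) Ω = 0 ∧
    l2 g g = l2 (g + (-(l2 g Ω / l2 Ω Ω)) • Ω) (g + (-(l2 g Ω / l2 Ω Ω)) • Ω) + (l2 g Ω / l2 Ω Ω) ^ 2 * l2 Ω Ω ∧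
    qform su2Rep β g g = qform su2Rep β (g + (-(l2 g Ω / l2 Ω Ω)) • Ω) (g + (-(l2 g Ω / l2 Ω Ω)) • Ω) +
      (l2 g Ω / l2 Ω Ω) ^ 2 * topValue su2Rep L β * l2 Ω Ω := by
  set a : ℝ := l2 g Ω / l2 Ω Ω with ha
  have haN : a * l2 Ω Ω = l2 g Ω := div_mul_cancel₀ _ hN.ne'
  have hgp : IsPhys (g + (-a) • Ω) := hg.add (hΩ.smul (-a))
  have horth : l2 (g + (-a) • Ω) Ω = 0 := by
    rw [l2_add_left hg (hΩ.smul (-a)) hΩ, l2_smul_left, ← haN]; ring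
  -- reconstruct `g = g_⊥ + aΩ`
  have hdec : g = (g + (-a) • Ω) + a • Ω := by
    funext U; simp only [Pi.add_apply, Pi.smul_apply, smul_eq_mul]; ring
  refine ⟨horth, ?_, ?_⟩
  · have h := l2_add_add hgp (hΩ.smul a)
    rw [← hdec, l2_comm (g + (-a) • Ω) (a • Ω), l2_smul_left, l2_comm Ω (g + (-a) • Ω), horth, l2_smul_left, l2_comm Ω (a • Ω),
      l2_smul_left] at h
    rw [h]; ring
  · have h := qform_add_add β hgp (hΩ.smul a)
    rw [← hdec, qform_smul_right β a hgp hΩ, qform_eigen_right β heig, horth, qform_smul_left, qform_smul_right β a hΩ hΩ,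
      qform_eigen_right β heig] at h
    rw [h]; ring



/-! ## §2 Localisation of the ground state by the gain -/

/-- ★ **The gain localises the ground state.**  `β > 0`; `Ω` positive physical with `K_βΩ = λ₀Ω`; `Θ` a measurable, gauge- and twist-invariant,
`Λ`-link-Lipschitz phase; `T = {S ≤ η}`; GAIN `⟨f,K_βf⟩ ≤ (1−γ)λ₀‖f‖²` (`γ > 0`) for physical `f` supported in `T ∩ {sin Θ ≠ 0}`.  Then
`‖Ω‖² ≤ ‖cos Θ·1_T·Ω‖² + ω‖Ω‖²` with `ω = κ_η/λ₀ + (2/(γλ₀))((1 + 2/γ)κ_η + ε)`, `κ_η = e^{−βη}c_β^{|E|}`, `ε = ½|E|²Λ²(3/β)c_β^{|E|}`.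
[cite: SimonB1983DiscreteSpectrum, §3] [cite: Luscher1983, §2] -/
theorem ground_far_mass_le {β : ℝ} (hβ : 0 < β) {Ω : GaugeConfig 3 L SU2 → ℝ} (hΩ : IsPhys Ω)
    (heig : transferApply β Ω = topValue su2Rep L β • Ω)
    {Θ : GaugeConfig 3 L SU2 → ℝ} (hΘm : Measurable Θ) {Λ : ℝ} (hΛ : 0 ≤ Λ)
    (hLip : ∀ U V : GaugeConfig 3 L SU2,
      |Θ U - Θ V| ≤ Λ * ∑ e, frobNorm ((U e : Matrix (Fin 2) (Fin 2) ℂ) - (V e : Matrix (Fin 2) (Fin 2) ℂ)))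
    (hΘg : ∀ (g : Site 3 L → SU2) (U : GaugeConfig 3 L SU2), Θ (gaugeTransform g U) = Θ U)
    (hΘz : ∀ (k : Fin 3), ∀ z ∈ Subgroup.center SU2, ∀ U : GaugeConfig 3 L SU2, Θ (twist k z U) = Θ U)
    (η : ℝ) {γ : ℝ} (hγ : 0 < γ)
    (hgain : ∀ f : GaugeConfig 3 L SU2 → ℝ, IsPhys f → (∀ U, f U ≠ 0 → wilsonAction su2Rep U ≤ η ∧ Real.sin (Θ U) ≠ 0) →
      qform su2Rep β f f ≤ (1 - γ) * topValue su2Rep L β * l2 f f) :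
    l2 Ω Ω ≤ l2 (fun U => Real.cos (Θ U) * {V | wilsonAction su2Rep V ≤ η}.indicator Ω U)
        (fun U => Real.cos (Θ U) * {V | wilsonAction su2Rep V ≤ η}.indicator Ω U) +
      ((Real.exp (-(β * η)) * latCE L β) / topValue su2Rep L β +
        2 / (γ * topValue su2Rep L β) * ((1 + 2 / γ) * (Real.exp (-(β * η)) * latCE L β) +
          (1 / 2) * ((Fintype.card (Edge 3 L) : ℝ) ^ 2 * Λ ^ 2 * (3 / β) * latCE L β))) * l2 Ω Ω := by
  set T : Set (GaugeConfig 3 L SU2) := {V | wilsonAction su2Rep V ≤ η} with hTdef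
  set w : GaugeConfig 3 L SU2 → ℝ := fun U => Real.cos (Θ U) * T.indicator Ω U with hwdef
  set u : GaugeConfig 3 L SU2 → ℝ := fun U => Real.sin (Θ U) * T.indicator Ω U with hudef
  set v : GaugeConfig 3 L SU2 → ℝ := fun U => Real.sin (Θ U) * Tᶜ.indicator Ω U with hvdef
  set gn : GaugeConfig 3 L SU2 → ℝ := fun U => Real.cos (Θ U) * Ω U with hgndef
  set gf : GaugeConfig 3 L SU2 → ℝ := fun U => Real.sin (Θ U) * Ω U with hgfdef
  -- cut-off bookkeeping
  have hcb : ∀ U, |Real.cos (Θ U)| ≤ 1 := fun U => Real.abs_cos_le_one _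
  have hsb : ∀ U, |Real.sin (Θ U)| ≤ 1 := fun U => Real.abs_sin_le_one _
  have hcm : Measurable fun U => Real.cos (Θ U) := Real.continuous_cos.measurable.comp hΘm
  have hsm : Measurable fun U => Real.sin (Θ U) := Real.continuous_sin.measurable.comp hΘm
  have hcg : ∀ (k : Site 3 L → SU2) (U : GaugeConfig 3 L SU2), Real.cos (Θ (gaugeTransform k U)) = Real.cos (Θ U) :=
    fun k U => by rw [hΘg]
  have hcz : ∀ (k : Fin 3), ∀ z ∈ Subgroup.center SU2, ∀ U : GaugeConfig 3 L SU2, Real.cos (Θ (twist k z U)) = Real.cos (Θ U) :=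
    fun k z hz U => by rw [hΘz k z hz]
  have hsg : ∀ (k : Site 3 L → SU2) (U : GaugeConfig 3 L SU2), Real.sin (Θ (gaugeTransform k U)) = Real.sin (Θ U) :=
    fun k U => by rw [hΘg]
  have hsz : ∀ (k : Fin 3), ∀ z ∈ Subgroup.center SU2, ∀ U : GaugeConfig 3 L SU2, Real.sin (Θ (twist k z U)) = Real.sin (Θ U) :=
    fun k z hz U => by rw [hΘz k z hz]
  have hΩT : IsPhys (T.indicator Ω) := isPhys_indicator_tube η hΩ
  have hΩTc : IsPhys (Tᶜ.indicator Ω) := isPhys_indicator_tube_compl η hΩ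
  have hw : IsPhys w := hΩT.mul_of_invariant hcm (CJ := 1) hcb hcg hcz
  have hu : IsPhys u := hΩT.mul_of_invariant hsm (CJ := 1) hsb hsg hsz
  have hv : IsPhys v := hΩTc.mul_of_invariant hsm (CJ := 1) hsb hsg hsz
  have hgn : IsPhys gn := hΩ.mul_of_invariant hcm (CJ := 1) hcb hcg hcz
  have hgf : IsPhys gf := hΩ.mul_of_invariant hsm (CJ := 1) hsb hsg hsz
  -- §A the tree estimates (IMS on `Ω`, eigen-pairing, large-field suppression off the tube), then the abbreviations
  have hIMS := qform_le_localized_cos_sin_lat hβ hΘm hΛ hLip hΘg hΘz hΩ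
  have hqΩ : qform su2Rep β Ω Ω = topValue su2Rep L β * l2 Ω Ω := qform_eigen_right β heig Ω
  have hvsupp : ∀ U, v U ≠ 0 → η ≤ wilsonAction su2Rep U := by
    intro U hU
    have h2 : Tᶜ.indicator Ω U ≠ 0 := fun h0 => hU (by simp only [hvdef, h0, mul_zero])
    have hUT : U ∈ Tᶜ := by
      by_contra hUT; exact h2 (Set.indicator_of_notMem hUT Ω)
    exact (lt_of_not_ge fun h => hUT h).le
  have hqv := qform_le_exp_neg_of_action_ge_lat hβ.le hv hvsupp
  have hcross := sq_cross_le hβ.le hu hv hvsupp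
  have htail := tail_bound hβ.le (T := T) (η := η) (fun U hU => (lt_of_not_ge fun h => hU h).le) hΩ hΩTc heig
  set lam : ℝ := topValue su2Rep L β with hlam
  set ε : ℝ := (1 / 2) * ((Fintype.card (Edge 3 L) : ℝ) ^ 2 * Λ ^ 2 * (3 / β) * latCE L β) with hεdef
  set κ : ℝ := Real.exp (-(β * η)) * latCE L β with hκdef
  have hlam0 : 0 < lam := topValue_su2Rep_pos L β
  have hκ0 : 0 ≤ κ := mul_nonneg (Real.exp_pos _).le (latCE_pos (L := L) hβ.le).le
  have hnsplit : l2 gn gn + l2 gf gf = l2 Ω Ω := by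
    unfold l2
    rw [← integral_add (hgn.integrable_mul hgn) (hgf.integrable_mul hgf)]
    refine integral_congr_ae (ae_of_all _ fun U => ?_)
    simp only [hgndef, hgfdef]
    have := Real.cos_sq_add_sin_sq (Θ U)
    linear_combination (Ω U ^ 2) * this
  have hgf_eq : gf = u + v := by
    funext U
    simp only [hgfdef, hudef, hvdef, Pi.add_apply]
    by_cases hU : U ∈ T
    · rw [Set.indicator_of_mem hU, Set.indicator_of_notMem (fun h : U ∈ Tᶜ => (Set.mem_compl_iff T U).1 h hU)]; ring
    · rw [Set.indicator_of_notMem hU, Set.indicator_of_mem ((Set.mem_compl_iff T U).2 hU)]; ring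
  have huv : l2 u v = 0 := by
    unfold l2
    refine (integral_congr_ae (ae_of_all _ fun U => ?_)).trans (integral_zero _ _)
    simp only [hudef, hvdef]
    by_cases hU : U ∈ T
    · rw [Set.indicator_of_notMem (fun h : U ∈ Tᶜ => (Set.mem_compl_iff T U).1 h hU)]; ring
    · rw [Set.indicator_of_notMem hU]; ring
  have hngf : l2 gf gf = l2 u u + l2 v v := by rw [hgf_eq, l2_add_add hu hv, huv]; ring
  have hTsplit : l2 (T.indicator Ω) (T.indicator Ω) = l2 w w + l2 u u := by
    unfold l2
    rw [← integral_add (hw.integrable_mul hw) (hu.integrable_mul hu)]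
    refine integral_congr_ae (ae_of_all _ fun U => ?_)
    simp only [hwdef, hudef]
    have := Real.cos_sq_add_sin_sq (Θ U)
    linear_combination (-(T.indicator Ω U ^ 2)) * this
  have hΩsplit : l2 Ω Ω = l2 (T.indicator Ω) (T.indicator Ω) + l2 (Tᶜ.indicator Ω) (Tᶜ.indicator Ω) :=
    l2_eq_indicator_add_compl hΩT hΩT hΩTc hΩTc
  -- §B the estimates
  have hqgn : qform su2Rep β gn gn ≤ lam * l2 gn gn := qform_le_topValue_mul_l2 hβ.le hgn
  have hqu : qform su2Rep β u u ≤ (1 - γ) * lam * l2 u u := by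
    refine hgain u hu fun U hU => ?_
    have h1 : Real.sin (Θ U) ≠ 0 := fun h0 => hU (by simp only [hudef, h0, zero_mul])
    have h2 : T.indicator Ω U ≠ 0 := fun h0 => hU (by simp only [hudef, h0, mul_zero])
    have hUT : U ∈ T := by
      by_contra hUT; exact h2 (Set.indicator_of_notMem hUT Ω)
    exact ⟨hUT, h1⟩
  have hnu0 : 0 ≤ l2 u u := l2_self_nonneg u
  have hnv0 : 0 ≤ l2 v v := l2_self_nonneg v
  have hnvΩ : l2 v v ≤ l2 Ω Ω := by
    have h1 : l2 v v ≤ l2 (Tᶜ.indicator Ω) (Tᶜ.indicator Ω) := by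
      unfold l2
      refine integral_mono (hv.integrable_mul hv) (hΩTc.integrable_mul hΩTc) fun U => ?_
      simp only [hvdef]
      have hs : Real.sin (Θ U) ^ 2 ≤ 1 := Real.sin_sq_le_one _
      have h0 : 0 ≤ Tᶜ.indicator Ω U * Tᶜ.indicator Ω U := mul_self_nonneg _
      have h1 := mul_le_mul_of_nonneg_right hs h0
      linarith only [h1]
    have h2 : l2 (Tᶜ.indicator Ω) (Tᶜ.indicator Ω) ≤ l2 Ω Ω := l2_indicator_compl_self_le hΩT hΩTc
    exact h1.trans h2
  -- AM–GM on the cross term: `2⟨u,Kv⟩ ≤ (γ/2)λ₀‖u‖² + (2/γ)κ‖v‖²`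
  have hAMGM : 2 * qform su2Rep β u v ≤ (γ / 2) * lam * l2 u u + (2 / γ) * κ * l2 v v := by
    have hA : 0 ≤ (γ / 2) * lam * l2 u u := by positivity
    have hB : 0 ≤ (2 / γ) * κ * l2 v v := by positivity
    have hγγ : (γ / 2) * (2 / γ) = 1 := by
      rw [div_mul_div_comm, mul_comm γ 2, div_self (mul_ne_zero two_ne_zero hγ.ne')]
    have hAB : ((γ / 2) * lam * l2 u u) * ((2 / γ) * κ * l2 v v) = (lam * l2 u u) * (κ * l2 v v) := by
      rw [show ((γ / 2) * lam * l2 u u) * ((2 / γ) * κ * l2 v v) = ((γ / 2) * (2 / γ)) * ((lam * l2 u u) * (κ * l2 v v)) by ring,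
        hγγ, one_mul]
    have hsq : (2 * qform su2Rep β u v) ^ 2 ≤ ((γ / 2) * lam * l2 u u + (2 / γ) * κ * l2 v v) ^ 2 := by
      linarith only [hcross, hAB, sq_nonneg ((γ / 2) * lam * l2 u u - (2 / γ) * κ * l2 v v)]
    exact (le_abs_self _).trans (abs_le_of_sq_le_sq hsq (add_nonneg hA hB))
  -- the expansion of the far piece
  have hqgf : qform su2Rep β gf gf = qform su2Rep β u u + 2 * qform su2Rep β u v + qform su2Rep β v v := by
    rw [hgf_eq, qform_add_add β hu hv]
  -- §C the mass bound for `u`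
  have hmass : (γ / 2) * lam * l2 u u ≤ ((1 + 2 / γ) * κ + ε) * l2 Ω Ω := by
    have h1 : lam * l2 Ω Ω ≤ lam * l2 gn gn + ((1 - γ) * lam * l2 u u + ((γ / 2) * lam * l2 u u + (2 / γ) * κ * l2 v v) +
        κ * l2 v v) + ε * l2 Ω Ω := by
      calc lam * l2 Ω Ω = qform su2Rep β Ω Ω := hqΩ.symm
        _ ≤ qform su2Rep β gn gn + qform su2Rep β gf gf + ε * l2 Ω Ω := hIMS
        _ ≤ lam * l2 gn gn + ((1 - γ) * lam * l2 u u + ((γ / 2) * lam * l2 u u + (2 / γ) * κ * l2 v v) + κ * l2 v v) +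
            ε * l2 Ω Ω := by rw [hqgf]; linarith only [hqgn, hqu, hAMGM, hqv]
    have e1 : lam * l2 gn gn = lam * l2 Ω Ω - lam * l2 u u - lam * l2 v v := by rw [← hnsplit, hngf]; ring
    have h2 : κ * l2 v v ≤ κ * l2 Ω Ω := mul_le_mul_of_nonneg_left hnvΩ hκ0
    have h3 : (2 / γ) * κ * l2 v v ≤ (2 / γ) * κ * l2 Ω Ω := mul_le_mul_of_nonneg_left hnvΩ (by positivity)
    have h4 : 0 ≤ lam * l2 v v := mul_nonneg hlam0.le hnv0
    linarith only [h1, e1, h2, h3, h4]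
  -- §D conclusion: `‖Ω‖² − ‖w‖² = ‖u‖² + ‖1_{Tᶜ}Ω‖²`
  have hγlam : 0 < γ / 2 * lam := by positivity
  have hnu : l2 u u ≤ 2 / (γ * lam) * ((1 + 2 / γ) * κ + ε) * l2 Ω Ω := by
    have hγl : 0 < γ * lam := mul_pos hγ hlam0
    rw [div_mul_eq_mul_div, div_mul_eq_mul_div, le_div_iff₀ hγl]
    have e : l2 u u * (γ * lam) = 2 * ((γ / 2) * lam * l2 u u) := by ring
    linarith only [hmass, e]
  have hnc : l2 (Tᶜ.indicator Ω) (Tᶜ.indicator Ω) ≤ κ / lam * l2 Ω Ω := by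
    rw [div_mul_eq_mul_div, le_div_iff₀ hlam0]
    linarith only [htail]
  calc l2 Ω Ω = l2 w w + (l2 u u + l2 (Tᶜ.indicator Ω) (Tᶜ.indicator Ω)) := by rw [hΩsplit, hTsplit]; ring
    _ ≤ l2 w w + (2 / (γ * lam) * ((1 + 2 / γ) * κ + ε) * l2 Ω Ω + κ / lam * l2 Ω Ω) := by linarith only [hnu, hnc]
    _ = l2 w w + (κ / lam + 2 / (γ * lam) * ((1 + 2 / γ) * κ + ε)) * l2 Ω Ω := by ring

end ValleyReloc

end Summit.QuantumFields.YangMills.Theorems.FemtoTransferGap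

end
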